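import Mathlib
import HarnessLib

/-!
# Product-measure plumbing on `(ℝ³)⁴` — helper for crux `BallSpecifiedInversionUpgrade`
# (stmt-CriticalPhenomena-11248), line `birth` (fourth-moment a-priori structure, part 1 of 2)

Route `route-CriticalPhenomena-BallSpecification`, sub-problem `Ising3DConformalLimit`.  Target tree file:
`Summits/CriticalPhenomena/Ising3DConformalLimit/Theorems/BallSpecificationBallSpecifiedInversionUpgradeFourthMomentPairSplit.lean`,
landed with `--supports stmt-CriticalPhenomena-11248` (helper lemmas; no registered stub is claimed).

Integrals over `(ℝ³)⁴` of products `H(x_a,x_b) K(x_c,x_d)` over DISJOINT pairs of coordinates factorise,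
`∫ H(x_a,x_b) K(x_c,x_d) dx = (∫ H)(∫ K)`, and such products are integrable when `H, K` are
(`Integrable.mul_prod` / `integral_prod_mul` transported along the measure-preserving split
`(ℝ³)⁴ ≃ (ℝ³)² × (ℝ³)²`, `volume_measurePreserving_piCongrLeft` + `volume_measurePreserving_sumPiEquivProdPi`,
and coordinate relabellings by permutations).  The three pairings `(01)(23)`, `(02)(13)`, `(03)(12)` are
spelled out in vector notation; they are consumed by the smeared GKS–Lebowitz sandwich of
`…FourthMoment.lean` (part 2).  References: Glimm–Jaffe, *Quantum Physics* (1987) §6.1 (moments of the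
continuum limit as integrals against Schwinger functions).  Theorem-only file (no definitions).
-/

noncomputable section

namespace Summit.CriticalPhenomena.Ising3DConformalLimit.BallSpecificationBallSpecifiedInversionUpgrade

open MeasureTheory

/-! ### Products over disjoint pairs of coordinates on `(ℝ³)⁴` -/

/-- **Splitting `(ℝ³)⁴ = (ℝ³)² × (ℝ³)²` along the coordinates `{0,1} | {2,3}`**: the integral of a product
of a function of `(x₀,x₁)` and a function of `(x₂,x₃)` is the product of the integrals (no integrability
needed: both sides carry the same junk values, `integral_prod_mul`). [folklore] -/
theorem fourthMoment_integral_split (H K : (Fin 2 → (EuclideanSpace ℝ (Fin 3))) → ℝ) :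
    ∫ x : Fin 4 → (EuclideanSpace ℝ (Fin 3)), H (fun i => x (Fin.castAdd 2 i)) * K (fun i => x (Fin.natAdd 2 i)) =
      (∫ y : Fin 2 → (EuclideanSpace ℝ (Fin 3)), H y) * (∫ z : Fin 2 → (EuclideanSpace ℝ (Fin 3)), K z) := by
  set e₁ := MeasurableEquiv.piCongrLeft (fun _ : Fin 4 => (EuclideanSpace ℝ (Fin 3))) (finSumFinEquiv (m := 2) (n := 2)) with he₁
  set e₂ := MeasurableEquiv.sumPiEquivProdPi (fun _ : Fin 2 ⊕ Fin 2 => (EuclideanSpace ℝ (Fin 3))) with he₂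
  have h₁ : MeasurePreserving e₁ volume volume :=
    volume_measurePreserving_piCongrLeft (fun _ : Fin 4 => (EuclideanSpace ℝ (Fin 3))) (finSumFinEquiv (m := 2) (n := 2))
  have h₂ : MeasurePreserving e₂ volume volume :=
    volume_measurePreserving_sumPiEquivProdPi (fun _ : Fin 2 ⊕ Fin 2 => (EuclideanSpace ℝ (Fin 3)))
  have h : MeasurePreserving (e₁ ∘ e₂.symm) volume volume := h₁.comp (h₂.symm e₂)
  have hemb : MeasurableEmbedding (e₁ ∘ e₂.symm) :=
    e₁.measurableEmbedding.comp e₂.symm.measurableEmbedding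
  rw [← h.integral_comp hemb, ← integral_prod_mul]
  congr 1
  funext p
  simp only [Function.comp_apply]
  congr 1
  · congr 1
    funext i
    rw [show (Fin.castAdd 2 i : Fin 4) = finSumFinEquiv (Sum.inl i) from
      (finSumFinEquiv_apply_left i).symm]
    rw [he₁, MeasurableEquiv.coe_piCongrLeft, he₂, MeasurableEquiv.coe_sumPiEquivProdPi_symm]
    exact Equiv.piCongrLeft_sumInl (fun _ : Fin 4 => (EuclideanSpace ℝ (Fin 3))) (finSumFinEquiv (m := 2) (n := 2)) p.1 p.2 i
  · congr 1
    funext i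
    rw [show (Fin.natAdd 2 i : Fin 4) = finSumFinEquiv (Sum.inr i) from
      (finSumFinEquiv_apply_right i).symm]
    rw [he₁, MeasurableEquiv.coe_piCongrLeft, he₂, MeasurableEquiv.coe_sumPiEquivProdPi_symm]
    exact Equiv.piCongrLeft_sumInr (fun _ : Fin 4 => (EuclideanSpace ℝ (Fin 3))) (finSumFinEquiv (m := 2) (n := 2)) p.1 p.2 i

/-- Integrability of a product over the disjoint coordinate pairs `{0,1} | {2,3}` (`Integrable.mul_prod`
transported along the measure-preserving split). [folklore] -/
theorem fourthMoment_integrable_split {H K : (Fin 2 → (EuclideanSpace ℝ (Fin 3))) → ℝ} (hH : Integrable H) (hK : Integrable K) :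
    Integrable (fun x : Fin 4 → (EuclideanSpace ℝ (Fin 3)) =>
      H (fun i => x (Fin.castAdd 2 i)) * K (fun i => x (Fin.natAdd 2 i))) := by
  set e₁ := MeasurableEquiv.piCongrLeft (fun _ : Fin 4 => (EuclideanSpace ℝ (Fin 3))) (finSumFinEquiv (m := 2) (n := 2)) with he₁
  set e₂ := MeasurableEquiv.sumPiEquivProdPi (fun _ : Fin 2 ⊕ Fin 2 => (EuclideanSpace ℝ (Fin 3))) with he₂
  have h₁ : MeasurePreserving e₁ volume volume :=
    volume_measurePreserving_piCongrLeft (fun _ : Fin 4 => (EuclideanSpace ℝ (Fin 3))) (finSumFinEquiv (m := 2) (n := 2))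
  have h₂ : MeasurePreserving e₂ volume volume :=
    volume_measurePreserving_sumPiEquivProdPi (fun _ : Fin 2 ⊕ Fin 2 => (EuclideanSpace ℝ (Fin 3)))
  have h : MeasurePreserving (e₁ ∘ e₂.symm) volume volume := h₁.comp (h₂.symm e₂)
  have hemb : MeasurableEmbedding (e₁ ∘ e₂.symm) :=
    e₁.measurableEmbedding.comp e₂.symm.measurableEmbedding
  have hprod : Integrable (fun p : (Fin 2 → (EuclideanSpace ℝ (Fin 3))) × (Fin 2 → (EuclideanSpace ℝ (Fin 3))) => H p.1 * K p.2) := hH.mul_prod hK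
  have key : (fun p : (Fin 2 → (EuclideanSpace ℝ (Fin 3))) × (Fin 2 → (EuclideanSpace ℝ (Fin 3))) => H p.1 * K p.2) =
      (fun x : Fin 4 → (EuclideanSpace ℝ (Fin 3)) => H (fun i => x (Fin.castAdd 2 i)) * K (fun i => x (Fin.natAdd 2 i))) ∘
        (e₁ ∘ e₂.symm) := by
    funext p
    simp only [Function.comp_apply]
    congr 1
    · congr 1
      funext i
      rw [show (Fin.castAdd 2 i : Fin 4) = finSumFinEquiv (Sum.inl i) from
        (finSumFinEquiv_apply_left i).symm]
      rw [he₁, MeasurableEquiv.coe_piCongrLeft, he₂, MeasurableEquiv.coe_sumPiEquivProdPi_symm]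
      exact (Equiv.piCongrLeft_sumInl (fun _ : Fin 4 => (EuclideanSpace ℝ (Fin 3))) (finSumFinEquiv (m := 2) (n := 2))
        p.1 p.2 i).symm
    · congr 1
      funext i
      rw [show (Fin.natAdd 2 i : Fin 4) = finSumFinEquiv (Sum.inr i) from
        (finSumFinEquiv_apply_right i).symm]
      rw [he₁, MeasurableEquiv.coe_piCongrLeft, he₂, MeasurableEquiv.coe_sumPiEquivProdPi_symm]
      exact (Equiv.piCongrLeft_sumInr (fun _ : Fin 4 => (EuclideanSpace ℝ (Fin 3))) (finSumFinEquiv (m := 2) (n := 2))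
        p.1 p.2 i).symm
  rw [key] at hprod
  exact (h.integrable_comp_emb hemb).1 hprod

/-- **Relabelling the coordinates** of `(ℝ³)⁴` by a permutation does not change the integral
(`volume_measurePreserving_piCongrLeft`). [folklore] -/
theorem fourthMoment_integral_comp_perm (F : (Fin 4 → (EuclideanSpace ℝ (Fin 3))) → ℝ) (σ : Equiv.Perm (Fin 4)) :
    ∫ x : Fin 4 → (EuclideanSpace ℝ (Fin 3)), F (fun i => x (σ i)) = ∫ x : Fin 4 → (EuclideanSpace ℝ (Fin 3)), F x := by
  have hmp := volume_measurePreserving_piCongrLeft (fun _ : Fin 4 => (EuclideanSpace ℝ (Fin 3))) σ.symm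
  have hcomp : (fun x : Fin 4 → (EuclideanSpace ℝ (Fin 3)) => F (fun i => x (σ i))) =
      F ∘ (MeasurableEquiv.piCongrLeft (fun _ : Fin 4 => (EuclideanSpace ℝ (Fin 3))) σ.symm) := by
    funext x
    simp only [Function.comp_apply, MeasurableEquiv.coe_piCongrLeft]
    congr 1
    funext i
    rw [Equiv.piCongrLeft_apply_eq_cast, cast_eq, Equiv.symm_symm]
  rw [hcomp]
  exact hmp.integral_comp (MeasurableEquiv.measurableEmbedding _) F

/-- Relabelling the coordinates preserves integrability. [folklore] -/
theorem fourthMoment_integrable_comp_perm {F : (Fin 4 → (EuclideanSpace ℝ (Fin 3))) → ℝ} (hF : Integrable F)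
    (σ : Equiv.Perm (Fin 4)) : Integrable (fun x : Fin 4 → (EuclideanSpace ℝ (Fin 3)) => F (fun i => x (σ i))) := by
  have hmp := volume_measurePreserving_piCongrLeft (fun _ : Fin 4 => (EuclideanSpace ℝ (Fin 3))) σ.symm
  have hcomp : (fun x : Fin 4 → (EuclideanSpace ℝ (Fin 3)) => F (fun i => x (σ i))) =
      F ∘ (MeasurableEquiv.piCongrLeft (fun _ : Fin 4 => (EuclideanSpace ℝ (Fin 3))) σ.symm) := by
    funext x
    simp only [Function.comp_apply, MeasurableEquiv.coe_piCongrLeft]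
    congr 1
    funext i
    rw [Equiv.piCongrLeft_apply_eq_cast, cast_eq, Equiv.symm_symm]
  rw [hcomp]
  exact (hmp.integrable_comp_emb (MeasurableEquiv.measurableEmbedding _)).2 hF

/-- The three pairings of four coordinates, in vector notation: pairing `(01)(23)`. [folklore] -/
theorem fourthMoment_integral_split01 (H K : (Fin 2 → (EuclideanSpace ℝ (Fin 3))) → ℝ) :
    ∫ x : Fin 4 → (EuclideanSpace ℝ (Fin 3)), H ![x 0, x 1] * K ![x 2, x 3] =
      (∫ y : Fin 2 → (EuclideanSpace ℝ (Fin 3)), H y) * (∫ z : Fin 2 → (EuclideanSpace ℝ (Fin 3)), K z) := by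
  rw [← fourthMoment_integral_split H K]
  congr 1
  funext x
  have h1 : (![x 0, x 1] : Fin 2 → (EuclideanSpace ℝ (Fin 3))) = fun i => x (Fin.castAdd 2 i) := by
    funext i; fin_cases i <;> rfl
  have h2 : (![x 2, x 3] : Fin 2 → (EuclideanSpace ℝ (Fin 3))) = fun i => x (Fin.natAdd 2 i) := by
    funext i; fin_cases i <;> rfl
  rw [h1, h2]

/-- Integrability for the pairing `(01)(23)`. [folklore] -/
theorem fourthMoment_integrable_split01 {H K : (Fin 2 → (EuclideanSpace ℝ (Fin 3))) → ℝ} (hH : Integrable H)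
    (hK : Integrable K) : Integrable (fun x : Fin 4 → (EuclideanSpace ℝ (Fin 3)) => H ![x 0, x 1] * K ![x 2, x 3]) := by
  refine (fourthMoment_integrable_split hH hK).congr (Filter.Eventually.of_forall fun x => ?_)
  have h1 : (![x 0, x 1] : Fin 2 → (EuclideanSpace ℝ (Fin 3))) = fun i => x (Fin.castAdd 2 i) := by
    funext i; fin_cases i <;> rfl
  have h2 : (![x 2, x 3] : Fin 2 → (EuclideanSpace ℝ (Fin 3))) = fun i => x (Fin.natAdd 2 i) := by
    funext i; fin_cases i <;> rfl
  simp only [h1, h2]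

/-- Pairing `(02)(13)`: `∫ H(x₀,x₂) K(x₁,x₃) = (∫ H)(∫ K)` (relabel by the transposition `(1 2)`).
[folklore] -/
theorem fourthMoment_integral_split02 (H K : (Fin 2 → (EuclideanSpace ℝ (Fin 3))) → ℝ) :
    ∫ x : Fin 4 → (EuclideanSpace ℝ (Fin 3)), H ![x 0, x 2] * K ![x 1, x 3] =
      (∫ y : Fin 2 → (EuclideanSpace ℝ (Fin 3)), H y) * (∫ z : Fin 2 → (EuclideanSpace ℝ (Fin 3)), K z) := by
  rw [← fourthMoment_integral_split01 H K,
    ← fourthMoment_integral_comp_perm (fun x => H ![x 0, x 1] * K ![x 2, x 3]) (Equiv.swap 1 2)]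
  rfl

/-- Integrability for the pairing `(02)(13)`. [folklore] -/
theorem fourthMoment_integrable_split02 {H K : (Fin 2 → (EuclideanSpace ℝ (Fin 3))) → ℝ} (hH : Integrable H)
    (hK : Integrable K) : Integrable (fun x : Fin 4 → (EuclideanSpace ℝ (Fin 3)) => H ![x 0, x 2] * K ![x 1, x 3]) :=
  fourthMoment_integrable_comp_perm (fourthMoment_integrable_split01 hH hK) (Equiv.swap 1 2)

/-- Pairing `(03)(12)`: `∫ H(x₀,x₃) K(x₁,x₂) = (∫ H)(∫ K)` (relabel by the 3-cycle `1 ↦ 3 ↦ 2 ↦ 1`).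
[folklore] -/
theorem fourthMoment_integral_split03 (H K : (Fin 2 → (EuclideanSpace ℝ (Fin 3))) → ℝ) :
    ∫ x : Fin 4 → (EuclideanSpace ℝ (Fin 3)), H ![x 0, x 3] * K ![x 1, x 2] =
      (∫ y : Fin 2 → (EuclideanSpace ℝ (Fin 3)), H y) * (∫ z : Fin 2 → (EuclideanSpace ℝ (Fin 3)), K z) := by
  rw [← fourthMoment_integral_split01 H K,
    ← fourthMoment_integral_comp_perm (fun x => H ![x 0, x 1] * K ![x 2, x 3])
      ((Equiv.swap (1 : Fin 4) 2).trans (Equiv.swap (2 : Fin 4) 3))]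
  rfl

/-- Integrability for the pairing `(03)(12)`. [folklore] -/
theorem fourthMoment_integrable_split03 {H K : (Fin 2 → (EuclideanSpace ℝ (Fin 3))) → ℝ} (hH : Integrable H)
    (hK : Integrable K) : Integrable (fun x : Fin 4 → (EuclideanSpace ℝ (Fin 3)) => H ![x 0, x 3] * K ![x 1, x 2]) :=
  fourthMoment_integrable_comp_perm (fourthMoment_integrable_split01 hH hK)
    ((Equiv.swap (1 : Fin 4) 2).trans (Equiv.swap (2 : Fin 4) 3))

/-- **Summary (registered sub-goal of stmt-CriticalPhenomena-11248)**: over `(ℝ³)⁴`, integrals of products of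
pair functions over the three pairings `(01)(23)`, `(02)(13)`, `(03)(12)` factorise, and such products of
integrable pair functions are integrable. [folklore] -/
theorem fourthMoment_pairSplit :
    ∀ (H K : (Fin 2 → EuclideanSpace ℝ (Fin 3)) → ℝ), (∫ x : Fin 4 → EuclideanSpace ℝ (Fin 3), H ![x 0, x 1] * K ![x 2, x 3] = (∫ y : Fin 2 → EuclideanSpace ℝ (Fin 3), H y) * (∫ z : Fin 2 → EuclideanSpace ℝ (Fin 3), K z)) ∧ (∫ x : Fin 4 → EuclideanSpace ℝ (Fin 3), H ![x 0, x 2] * K ![x 1, x 3] = (∫ y : Fin 2 → EuclideanSpace ℝ (Fin 3), H y) * (∫ z : Fin 2 → EuclideanSpace ℝ (Fin 3), K z)) ∧ (∫ x : Fin 4 → EuclideanSpace ℝ (Fin 3), H ![x 0, x 3] * K ![x 1, x 2] = (∫ y : Fin 2 → EuclideanSpace ℝ (Fin 3), H y) * (∫ z : Fin 2 → EuclideanSpace ℝ (Fin 3), K z)) ∧ (MeasureTheory.Integrable H → MeasureTheory.Integrable K → MeasureTheory.Integrable (fun x : Fin 4 → EuclideanSpace ℝ (Fin 3) => H ![x 0,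 x 1] * K ![x 2, x 3]) ∧ MeasureTheory.Integrable (fun x : Fin 4 → EuclideanSpace ℝ (Fin 3) => H ![x 0, x 2] * K ![x 1, x 3]) ∧ MeasureTheory.Integrable (fun x : Fin 4 → EuclideanSpace ℝ (Fin 3) => H ![x 0, x 3] * K ![x 1, x 2])) :=
  fun H K => ⟨fourthMoment_integral_split01 H K, fourthMoment_integral_split02 H K,
    fourthMoment_integral_split03 H K, fun hH hK => ⟨fourthMoment_integrable_split01 hH hK,
      fourthMoment_integrable_split02 hH hK, fourthMoment_integrable_split03 hH hK⟩⟩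

end Summit.CriticalPhenomena.Ising3DConformalLimit.BallSpecificationBallSpecifiedInversionUpgrade

end
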